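import Summits.AtomisticToContinuum.FouriersLaw.Theorems.HiddenChargeMazurNoOddChargeGibbsBounds

/-!
# Sub-extensive block overlap (stub S2b of crux `DressedCharge`) — local observables vs. the current

Helper file for stub `stub_blockOverlap` (S2b) of line `birth` of the crux
`Summit.AtomisticToContinuum.FouriersLaw.Theses.HiddenChargeMazur.DressedCharge`
(item stmt-AtomisticToContinuum-13509, route `HiddenChargeMazur`); a `--supports` file, it closes
no item by itself.

Abstract version of the `NoOddCharge` two-site statics for an ARBITRARY energy-dominated continuous
observable `G` of the pinned anharmonic chain `pinnedChain ω₂ lam β γ` under the Gibbs measure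
`μ = Z⁻¹ e^{-H/T}`:
* far bonds are orthogonal: if `G` does not depend on `p_k, p_{k+1}` then `∫ j_k G e^{-H/T} = 0`
  (`j_k = -½ (p_k + p_{k+1}) V'(q_{k+1} - q_k)`, one integration by parts in each momentum);
* touching bonds by Cauchy–Schwarz: `|E_μ[j_k G]| ≤ √(N K₀ B)` whenever `E_μ[G²] ≤ B`
  (`E_μ[j_k²] ≤ N K₀`, `K₀ = 2T² + 384 β² T³/(lam ω₂)`);
* total current: if `G` depends on the momenta only through the sites `e(0), …, e(L-1)` then at most
  `2L` bonds touch and `|E_μ[J_N G]| ≤ 2L √(N K₀ B)`; and `J_N G` is `μ`-integrable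
  (registered sub-goal `stub_blockOverlap_localObs`).
-/

noncomputable section

open MeasureTheory
open scoped BigOperators
open Literature.MathematicalPhysics.KineticTheory.HeatConduction
open Summit.AtomisticToContinuum.FouriersLaw.Theorems.SubdiffusiveBondHeat
open Summit.AtomisticToContinuum.FouriersLaw.Theorems.LightConeBondHeat
open Summit.AtomisticToContinuum.FouriersLaw.Theorems.NoOddCharge

namespace Summit.AtomisticToContinuum.FouriersLaw.Theorems.DressedCharge

variable {ω₂ lam β : ℝ}

/-! ### Far bonds are orthogonal to momentum-local observables -/

/-- **Orthogonality of far bonds (abstract).** If `G` is continuous, dominated by a power of the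
energy and unchanged when `p_k` or `p_{k+1}` is modified, then `∫ j_k G e^{-H/T} = 0`
(template: `NoOddCharge.pinnedChain_integral_bondCurrent_mul_twoSite_eq_zero`). [folklore] -/
theorem pinnedChain_integral_bondCurrent_mul_eq_zero_of_update (hω : 0 < ω₂) (hl : 0 ≤ lam)
    (hβ : 0 ≤ β) (γ : ℝ) (N : ℕ) {T : ℝ} (hT : 0 < T) {G : PhaseSpace N → ℝ} (hGc : Continuous G)
    {C : ℝ} (m : ℕ) (hle : ∀ z, |G z| ≤ C * (1 + (pinnedChain ω₂ lam β γ).hamiltonian N z) ^ m)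
    (k : Fin N) (hinvk : ∀ (z : PhaseSpace N) (t : ℝ), G (z.1, Function.update z.2 k t) = G z)
    (hinvl : ∀ (h : k.val + 1 < N) (z : PhaseSpace N) (t : ℝ),
      G (z.1, Function.update z.2 ⟨k.val + 1, h⟩ t) = G z) :
    ∫ z, (pinnedChain ω₂ lam β γ).bondCurrent N k z * G z *
      (pinnedChain ω₂ lam β γ).gibbsDensity N T z = 0 := by
  set P := pinnedChain ω₂ lam β γ with hP
  by_cases hk : k.val + 1 < N
  · have hinvl0 : ∀ (z : PhaseSpace N) (t : ℝ), G (z.1, Function.update z.2 ⟨k.val + 1, hk⟩ t) = G z :=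
      hinvl hk
    set l : Fin N := ⟨k.val + 1, hk⟩ with hl'
    set G' : PhaseSpace N → ℝ := fun z => deriv P.V (z.1 l - z.1 k) * G z with hG'
    have hGc' : Continuous G' := by
      simp only [hG', hP, pinnedChain_deriv_V]
      exact (by fun_prop : Continuous fun z : PhaseSpace N => (z.1 l - z.1 k) + β * (z.1 l - z.1 k) ^ 3).mul hGc
    have hGle' : ∀ z, |G' z| ≤ (3 + β) * C * (1 + P.hamiltonian N z) ^ (m + 1) := by
      intro z
      simp only [hG']
      rw [abs_mul]
      have hH0 := pinnedChain_hamiltonian_nonneg hω.le hl hβ γ N z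
      have hV : |deriv P.V (z.1 l - z.1 k)| ≤ (3 + β) * (1 + P.hamiltonian N z) := by
        have := (pinnedChain_bond_bounds hω.le hl hβ γ N z (k := k) (l := l) rfl).2.2
        rw [← sq_abs, ← mul_pow] at this
        exact abs_le_of_sq_le_sq' this (by positivity) |>.2
      calc |deriv P.V (z.1 l - z.1 k)| * |G z|
          ≤ ((3 + β) * (1 + P.hamiltonian N z)) * (C * (1 + P.hamiltonian N z) ^ m) :=
            mul_le_mul hV (hle z) (abs_nonneg _) (by positivity)
        _ = _ := by ring
    have hinvk' : ∀ (z : PhaseSpace N) (t : ℝ), G' (z.1, Function.update z.2 k t) = G' z := by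
      intro z t
      simp only [hG', hinvk z t]
    have hinvl' : ∀ (z : PhaseSpace N) (t : ℝ), G' (z.1, Function.update z.2 l t) = G' z := by
      intro z t
      simp only [hG', hinvl0 z t]
    have e1 := pinnedChain_integral_momentum_mul_eq_zero hω hl hβ γ N hT k hGc' (m + 1) hGle' hinvk'
    have e2 := pinnedChain_integral_momentum_mul_eq_zero hω hl hβ γ N hT l hGc' (m + 1) hGle' hinvl'
    have hsplit : (fun z => P.bondCurrent N k z * G z * P.gibbsDensity N T z) =
        fun z => (-1/2 : ℝ) * (z.2 k * G' z * P.gibbsDensity N T z) +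
          (-1/2 : ℝ) * (z.2 l * G' z * P.gibbsDensity N T z) := by
      funext z
      rw [bondCurrent_eq_of_lt P hk z]
      simp only [hG']
      ring
    have hI : ∀ i : Fin N, Integrable fun z => z.2 i * G' z * P.gibbsDensity N T z := by
      intro i
      refine pinnedChain_integrable_mul_gibbsDensity_of_le_pow hω hl hβ γ N hT (m + 1 + 2)
        (g := fun z => z.2 i * G' z) ((by fun_prop : Continuous fun z : PhaseSpace N => z.2 i).mul hGc')
        (C := 4 * ((3 + β) * C)) fun z => ?_
      rw [abs_mul]
      have h2 := pinnedChain_abs_momentum_pow_le_pow hω.le hl hβ γ N z i 1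
      rw [pow_one, pow_one, mul_one] at h2
      have hH0 := pinnedChain_hamiltonian_nonneg hω.le hl hβ γ N z
      calc |z.2 i| * |G' z| ≤ (4 * (1 + P.hamiltonian N z) ^ 2) *
            ((3 + β) * C * (1 + P.hamiltonian N z) ^ (m + 1)) :=
            mul_le_mul h2 (hGle' z) (abs_nonneg _) (by positivity)
        _ = _ := by ring
    rw [hsplit, integral_add ((hI k).const_mul _) ((hI l).const_mul _), integral_const_mul,
      integral_const_mul, e1, e2]
    ring
  · have hj : ∀ z, P.bondCurrent N k z = 0 := by
      intro z
      unfold OscillatorChain.bondCurrent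
      refine Finset.sum_eq_zero fun j _ => ?_
      rw [if_neg]
      intro hv
      exact hk (hv ▸ j.isLt)
    simp [hj]

/-! ### Touching bonds: Cauchy–Schwarz -/

/-- **Integrability of `G²`.** For a continuous `G` with `|G| ≤ C (1+H)^m`, `G²` is `μ`-integrable.
[folklore] -/
theorem pinnedChain_integrable_gibbs_sq (hω : 0 < ω₂) (hl : 0 ≤ lam) (hβ : 0 ≤ β)
    (γ : ℝ) (N : ℕ) {T : ℝ} (hT : 0 < T) {G : PhaseSpace N → ℝ} (hGc : Continuous G) {C : ℝ} (m : ℕ)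
    (hle : ∀ z, |G z| ≤ C * (1 + (pinnedChain ω₂ lam β γ).hamiltonian N z) ^ m) :
    Integrable (fun z => (G z) ^ 2) ((pinnedChain ω₂ lam β γ).gibbsMeasure N T) := by
  refine (pinnedChain ω₂ lam β γ).integrable_gibbsMeasure
    (pinnedChain_integrable_mul_gibbsDensity_of_le_pow hω hl hβ γ N hT (m * 2) (hGc.pow 2) (C := C ^ 2)
      fun z => ?_)
  rw [abs_pow, pow_mul, ← mul_pow]
  exact pow_le_pow_left₀ (abs_nonneg _) (hle z) 2

/-- **Integrability of `j_k G`.** For a continuous `G` with `|G| ≤ C (1+H)^m`, `z ↦ j_k(z) G(z)` is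
`μ`-integrable (`|j_k| ≤ N (3+β)/2 · (1+H)²`). [folklore] -/
theorem pinnedChain_integrable_gibbs_bondCurrent_mul (hω : 0 < ω₂) (hl : 0 ≤ lam) (hβ : 0 ≤ β)
    (γ : ℝ) (N : ℕ) {T : ℝ} (hT : 0 < T) {G : PhaseSpace N → ℝ} (hGc : Continuous G) {C : ℝ} (m : ℕ)
    (hle : ∀ z, |G z| ≤ C * (1 + (pinnedChain ω₂ lam β γ).hamiltonian N z) ^ m) (k : Fin N) :
    Integrable (fun z => (pinnedChain ω₂ lam β γ).bondCurrent N k z * G z)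
      ((pinnedChain ω₂ lam β γ).gibbsMeasure N T) := by
  set P := pinnedChain ω₂ lam β γ with hP
  have hjc : Continuous (P.bondCurrent N k) := pinnedChain_continuous_bondCurrent ω₂ lam β γ N k
  have hjle : ∀ z, |P.bondCurrent N k z| ≤ N * ((3 + β) / 2) * (1 + P.hamiltonian N z) ^ 2 := by
    intro z
    have := pinnedChain_abs_bondCurrent_le hω.le hl hβ γ N k z
    linarith
  refine P.integrable_gibbsMeasure (pinnedChain_integrable_mul_gibbsDensity_of_le_pow hω hl hβ γ N hT
    (2 + m) (hjc.mul hGc) (C := N * ((3 + β) / 2) * C) fun z => ?_)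
  rw [abs_mul]
  have hH0 := pinnedChain_hamiltonian_nonneg hω.le hl hβ γ N z
  have hC0 : 0 ≤ C * (1 + P.hamiltonian N z) ^ m := (abs_nonneg _).trans (hle z)
  calc |P.bondCurrent N k z| * |G z|
      ≤ (N * ((3 + β) / 2) * (1 + P.hamiltonian N z) ^ 2) * (C * (1 + P.hamiltonian N z) ^ m) :=
        mul_le_mul (hjle z) (hle z) (abs_nonneg _) (by positivity)
    _ = _ := by ring

/-- **Correlation bound (abstract).** `|E_μ[j_k G]| ≤ √(N K₀ B)` for a continuous energy-dominated
`G` with `E_μ[G²] ≤ B` (`K₀ = 2T² + 384β²T³/(lam ω₂)`; Cauchy–Schwarz with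
`NoOddCharge.pinnedChain_gibbs_sq_bondCurrent_le`). [folklore] -/
theorem pinnedChain_gibbs_abs_bondCurrent_mul_le_sqrt (hω : 0 < ω₂) (hl : 0 < lam) (hβ : 0 < β)
    (γ : ℝ) (N : ℕ) {T : ℝ} (hT : 0 < T) {G : PhaseSpace N → ℝ} (hGc : Continuous G) {C : ℝ} (m : ℕ)
    (hle : ∀ z, |G z| ≤ C * (1 + (pinnedChain ω₂ lam β γ).hamiltonian N z) ^ m) {B : ℝ}
    (hB : ∫ z, (G z) ^ 2 ∂((pinnedChain ω₂ lam β γ).gibbsMeasure N T) ≤ B) (k : Fin N) :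
    |∫ z, (pinnedChain ω₂ lam β γ).bondCurrent N k z * G z ∂((pinnedChain ω₂ lam β γ).gibbsMeasure N T)| ≤
      Real.sqrt (N * (2 * T ^ 2 + 384 * β ^ 2 * T ^ 3 / (lam * ω₂)) * B) := by
  set P := pinnedChain ω₂ lam β γ with hP
  set μ := P.gibbsMeasure N T with hμ
  have hjc : Continuous (P.bondCurrent N k) := pinnedChain_continuous_bondCurrent ω₂ lam β γ N k
  have hjle : ∀ z, |P.bondCurrent N k z| ≤ N * ((3 + β) / 2) * (1 + P.hamiltonian N z) ^ 2 := by
    intro z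
    have := pinnedChain_abs_bondCurrent_le hω.le hl.le hβ.le γ N k z
    linarith
  have hI2j : Integrable (fun z => (P.bondCurrent N k z) ^ 2) μ := by
    refine P.integrable_gibbsMeasure (pinnedChain_integrable_mul_gibbsDensity_of_le_pow hω hl.le hβ.le γ N
      hT 4 (hjc.pow 2) (C := (N * ((3 + β) / 2)) ^ 2) fun z => ?_)
    rw [abs_pow, show (4:ℕ) = 2 * 2 from rfl, pow_mul, ← mul_pow]
    exact pow_le_pow_left₀ (abs_nonneg _) (hjle z) 2
  have hIjG := pinnedChain_integrable_gibbs_bondCurrent_mul hω hl.le hβ.le γ N hT hGc m hle k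
  have hI2G := pinnedChain_integrable_gibbs_sq hω hl.le hβ.le γ N hT hGc m hle
  have hcs := sq_integral_mul_le μ hI2j hI2G hIjG
  have h1 := pinnedChain_gibbs_sq_bondCurrent_le hω hl hβ γ N hT k
  have h1' : 0 ≤ ∫ z, (P.bondCurrent N k z) ^ 2 ∂μ := integral_nonneg fun z => sq_nonneg _
  have h2' : 0 ≤ ∫ z, (G z) ^ 2 ∂μ := integral_nonneg fun z => sq_nonneg _
  rw [← Real.sqrt_sq (abs_nonneg _), sq_abs]
  exact Real.sqrt_le_sqrt (hcs.trans (mul_le_mul h1 hB h2' (by positivity)))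

/-! ### The total current against a momentum-local observable -/

/-- **Integrability of `J_N G`.** For a continuous energy-dominated `G`, `(∑_k j_k) G` is
`μ`-integrable. [folklore] -/
theorem pinnedChain_integrable_gibbs_totalCurrent_mul (hω : 0 < ω₂) (hl : 0 ≤ lam) (hβ : 0 ≤ β)
    (γ : ℝ) (N : ℕ) {T : ℝ} (hT : 0 < T) {G : PhaseSpace N → ℝ} (hGc : Continuous G) {C : ℝ} (m : ℕ)
    (hle : ∀ z, |G z| ≤ C * (1 + (pinnedChain ω₂ lam β γ).hamiltonian N z) ^ m) :
    Integrable (fun z => (∑ k : Fin N, (pinnedChain ω₂ lam β γ).bondCurrent N k z) * G z)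
      ((pinnedChain ω₂ lam β γ).gibbsMeasure N T) := by
  have h : ∀ k : Fin N, Integrable (fun z => (pinnedChain ω₂ lam β γ).bondCurrent N k z * G z)
      ((pinnedChain ω₂ lam β γ).gibbsMeasure N T) := fun k =>
    pinnedChain_integrable_gibbs_bondCurrent_mul hω hl hβ γ N hT hGc m hle k
  refine (integrable_finsetSum Finset.univ fun k _ => h k).congr
    (Filter.Eventually.of_forall fun z => ?_)
  simp [Finset.sum_mul]

/-- **Total current against a momentum-local observable (abstract).** Let `G` be continuous,
energy-dominated, with `E_μ[G²] ≤ B`, and unchanged when any momentum `p_k` with `k ∉ {e 0, …, e (L-1)}`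
is modified. Then only the (at most `2L`) bonds touching the sites `e i` correlate with `G`, and
`|E_μ[J_N G]| ≤ 2L √(N K₀ B)`. [folklore] -/
theorem pinnedChain_gibbs_abs_totalCurrent_mul_le (hω : 0 < ω₂) (hl : 0 < lam) (hβ : 0 < β)
    (γ : ℝ) (N : ℕ) {T : ℝ} (hT : 0 < T) {G : PhaseSpace N → ℝ} (hGc : Continuous G) {C : ℝ} (m : ℕ)
    (hle : ∀ z, |G z| ≤ C * (1 + (pinnedChain ω₂ lam β γ).hamiltonian N z) ^ m) {B : ℝ}
    (hB : ∫ z, (G z) ^ 2 ∂((pinnedChain ω₂ lam β γ).gibbsMeasure N T) ≤ B) {L : ℕ} (e : Fin L → ℕ)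
    (hinv : ∀ k : Fin N, (∀ i, e i ≠ k.val) →
      ∀ (z : PhaseSpace N) (t : ℝ), G (z.1, Function.update z.2 k t) = G z) :
    |∫ z, (∑ k : Fin N, (pinnedChain ω₂ lam β γ).bondCurrent N k z) * G z
        ∂((pinnedChain ω₂ lam β γ).gibbsMeasure N T)| ≤
      2 * L * Real.sqrt (N * (2 * T ^ 2 + 384 * β ^ 2 * T ^ 3 / (lam * ω₂)) * B) := by
  set P := pinnedChain ω₂ lam β γ with hP
  set μ := P.gibbsMeasure N T with hμ
  set R : ℝ := Real.sqrt (N * (2 * T ^ 2 + 384 * β ^ 2 * T ^ 3 / (lam * ω₂)) * B) with hR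
  have hR0 : 0 ≤ R := Real.sqrt_nonneg _
  have hIjG : ∀ k : Fin N, Integrable (fun z => P.bondCurrent N k z * G z) μ := fun k =>
    pinnedChain_integrable_gibbs_bondCurrent_mul hω hl.le hβ.le γ N hT hGc m hle k
  have hsplit : ∫ z, (∑ k : Fin N, P.bondCurrent N k z) * G z ∂μ =
      ∑ k : Fin N, ∫ z, P.bondCurrent N k z * G z ∂μ := by
    rw [← integral_finsetSum _ fun k _ => hIjG k]
    refine integral_congr_ae (Filter.Eventually.of_forall fun z => ?_)
    simp [Finset.sum_mul]
  rw [hsplit]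
  -- each bond: `≤ R` if it touches one of the sites `e i`, `0` otherwise
  have hterm : ∀ k : Fin N, |∫ z, P.bondCurrent N k z * G z ∂μ| ≤
      R * ∑ i : Fin L, ((if e i = k.val then (1:ℝ) else 0) + (if e i = k.val + 1 then (1:ℝ) else 0)) := by
    intro k
    have hS0 : ∀ i : Fin L, 0 ≤ (if e i = k.val then (1:ℝ) else 0) + (if e i = k.val + 1 then (1:ℝ) else 0) :=
      fun i => by positivity
    by_cases ht : ∃ i : Fin L, e i = k.val ∨ e i = k.val + 1
    · obtain ⟨i, hi⟩ := ht
      have hge : (1:ℝ) ≤ ∑ i : Fin L,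
          ((if e i = k.val then (1:ℝ) else 0) + (if e i = k.val + 1 then (1:ℝ) else 0)) := by
        refine le_trans ?_ (Finset.single_le_sum (fun i _ => hS0 i) (Finset.mem_univ i))
        rcases hi with h | h
        · rw [if_pos h]
          have : 0 ≤ (if e i = k.val + 1 then (1:ℝ) else 0) := by positivity
          linarith
        · rw [if_pos h]
          have : 0 ≤ (if e i = k.val then (1:ℝ) else 0) := by positivity
          linarith
      calc |∫ z, P.bondCurrent N k z * G z ∂μ| ≤ R :=
            pinnedChain_gibbs_abs_bondCurrent_mul_le_sqrt hω hl hβ γ N hT hGc m hle hB k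
        _ = R * 1 := (mul_one R).symm
        _ ≤ _ := mul_le_mul_of_nonneg_left hge hR0
    · push Not at ht
      have h0 : ∫ z, P.bondCurrent N k z * G z ∂μ = 0 := by
        rw [P.integral_gibbsMeasure,
          pinnedChain_integral_bondCurrent_mul_eq_zero_of_update hω hl.le hβ.le γ N hT hGc m hle k
            (hinv k fun i => (ht i).1) (fun h => hinv ⟨k.val + 1, h⟩ fun i => (ht i).2)]
        simp
      rw [h0, abs_zero]
      exact mul_nonneg hR0 (Finset.sum_nonneg fun i _ => hS0 i)
  have hcount : ∀ i : Fin L,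
      (∑ k : Fin N, ((if e i = k.val then (1:ℝ) else 0) + (if e i = k.val + 1 then (1:ℝ) else 0))) ≤ 2 := by
    intro i
    rw [Finset.sum_add_distrib]
    have h1 := sum_boole_le_one (N := N) (P := fun k : Fin N => e i = k.val)
      (fun k k' h h' => Fin.ext (by omega))
    have h2 := sum_boole_le_one (N := N) (P := fun k : Fin N => e i = k.val + 1)
      (fun k k' h h' => Fin.ext (by omega))
    linarith
  calc |∑ k : Fin N, ∫ z, P.bondCurrent N k z * G z ∂μ|
      ≤ ∑ k : Fin N, |∫ z, P.bondCurrent N k z * G z ∂μ| := Finset.abs_sum_le_sum_abs _ _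
    _ ≤ ∑ k : Fin N, R * ∑ i : Fin L,
          ((if e i = k.val then (1:ℝ) else 0) + (if e i = k.val + 1 then (1:ℝ) else 0)) :=
        Finset.sum_le_sum fun k _ => hterm k
    _ = R * ∑ i : Fin L, ∑ k : Fin N,
          ((if e i = k.val then (1:ℝ) else 0) + (if e i = k.val + 1 then (1:ℝ) else 0)) := by
        rw [← Finset.mul_sum, Finset.sum_comm]
    _ ≤ R * ∑ _i : Fin L, (2:ℝ) :=
        mul_le_mul_of_nonneg_left (Finset.sum_le_sum fun i _ => hcount i) hR0
    _ = 2 * L * R := by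
        rw [Finset.sum_const, Finset.card_univ, Fintype.card_fin, nsmul_eq_mul]
        ring

/-! ### Registered sub-goal of stub S2b: momentum-local observables -/

/-- **Registered helper stub `stub_blockOverlap_localObs` of S2b.** For the pinned anharmonic chain
(`ω₂, lam, β, T > 0`): if `G` is continuous, `|G| ≤ C(1+H)^m`, `E_μ[G²] ≤ B`, and `G` is unchanged
when a momentum `p_k` with `k ∉ {e 0, …, e (L-1)}` is modified, then `J_N G` is `μ`-integrable and
`|E_μ[J_N G]| ≤ 2L √(N K₀ B)`, `K₀ = 2T² + 384β²T³/(lam ω₂)`. [folklore] -/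
theorem stub_blockOverlap_localObs :
    ∀ ω₂ lam β γ T : ℝ, 0 < ω₂ → 0 < lam → 0 < β → 0 < T →
    ∀ (N : ℕ) (G : PhaseSpace N → ℝ) (C : ℝ) (m : ℕ) (B : ℝ) (L : ℕ) (e : Fin L → ℕ),
      Continuous G → (∀ z, |G z| ≤ C * (1 + (pinnedChain ω₂ lam β γ).hamiltonian N z) ^ m) →
      ∫ z, (G z) ^ 2 ∂((pinnedChain ω₂ lam β γ).gibbsMeasure N T) ≤ B →
      (∀ k : Fin N, (∀ i, e i ≠ k.val) → ∀ (z : PhaseSpace N) (t : ℝ), G (z.1, Function.update z.2 k t) = G z) →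
      MeasureTheory.Integrable (fun z => (∑ k : Fin N, (pinnedChain ω₂ lam β γ).bondCurrent N k z) * G z)
          ((pinnedChain ω₂ lam β γ).gibbsMeasure N T) ∧
        |∫ z, (∑ k : Fin N, (pinnedChain ω₂ lam β γ).bondCurrent N k z) * G z
            ∂((pinnedChain ω₂ lam β γ).gibbsMeasure N T)| ≤
          2 * L * Real.sqrt (N * (2 * T ^ 2 + 384 * β ^ 2 * T ^ 3 / (lam * ω₂)) * B) := by
  intro ω₂ lam β γ T hω hl hβ hT N G C m B L e hGc hle hB hinv
  exact ⟨pinnedChain_integrable_gibbs_totalCurrent_mul hω hl.le hβ.le γ N hT hGc m hle,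
    pinnedChain_gibbs_abs_totalCurrent_mul_le hω hl hβ γ N hT hGc m hle hB e hinv⟩

end Summit.AtomisticToContinuum.FouriersLaw.Theorems.DressedCharge

end
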